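import Summits.QuantumFields.BalabanUV.Beta.EriceRemainderEnclosureHistoryAutonomyComparisonDefect

/-!
# EriceRemainderEnclosureHistoryAutonomyComparisonDefectOscillation — (E140c) **SIGN-FREE EXCESSES WITH AN OSCILLATION: COMPARISON DEGRADES BY AT MOST
# `θδ∕(1−θ)` PER SCALE IN THE LEVEL.**  (E140a)'s class — `B` isotone on `]0,γ]^ℕ` (floor `b > 0`, zeroth moment `M`), level-Lipschitz age profile `Λ ≥ 0` on the graded
# box with STRICT moment `θ = Σ_{k<K} k·Λ_k < 1`; `B ≤ B′ ≤ β̄` — but now the excess `D = B′ − B` is allowed BOTH a multiplicative defect `τ ≥ 0` AND an ADDITIVE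
# OSCILLATION `δ ≥ 0`:  `u ≤ v ⟹ D u ≤ (1+τ)·D v + δ`  (every bounded non-negative excess has this shape with `τ = 0`, `δ = sup D − inf D`).  If `(1+τ)θ ≤ 1` then
# for ANY box solutions `h, h′` of `B, B′` from one pin and every scale `j`:
#   **`1∕h′_j² ≥ 1∕h_j² − j·θδ∕(1−θ)`**  (`level_deficit_le`)
# — the perturbed coupling can exceed the base coupling, but only by a LEVEL DEFICIT growing at most linearly in the depth with slope `θδ∕(1−θ)`; `δ = 0` is (E140a)'s
# comparison.  On (E49b)'s switch (`τ = 0`, `δ = σ`, `θ = M`) the true scale-1 deficit is `Mσ∕(1+M)` against the bound `Mσ∕(1−M)`: sharp to first order in `θ`.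

Cell `pub-balaban`, β-function sub-cell, BINDER row D4 «RemainderConst leaves for Bałaban's split» (`HOME/BINDER-OWNERS.md`; owner lineage `b2b-balaban-beta-an4`;
this file by co-owner #2 lineage `b2b-balaban-beta-d4-p2`, generation 108), β-FLOW TEAM duty (1), FREEZE (0) honoured (def-free; (E138b) `flow_link_lower` ∕
`flow_link_upper` ∕ `flow_violation_bound`, (E138a) `dual_step_eq_levels` ∕ `gap_le_sum_parts`, (E48a) `strictAnti_of_memFlow`, (E39) `exists_memFlow_zm`, (E43b)
`memFlow_unique_of_monotone_zm` BY NAME; nothing restated).  Completes the answer to item (β) of `HOME/b2b-balaban-beta-d4-p2/g107/README.md` §4: the multiplicative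
defect decides comparison EXACTLY ((E140a)∕(E140b)); the additive oscillation degrades it BOUNDEDLY (this file).

HONEST FRAMING (page 1, verbatim and binding).  *"Discharging BetaPertH makes Bałaban's UV stability UNCONDITIONAL — a real constructive-QFT result; it is
NOT the continuum limit and NOT the Clay problem."*  THIS FILE DISCHARGES NOTHING OF THE KIND.  Elementary real analysis about ABSTRACT functionals on a box
]0,γ]^ℕ (node U2's `MemFlow` ∕ `SeqBox`) — hypotheses of a census, not facts: nothing about Bałaban's (1.22) limit functional or the oscillation of any remainder
perturbation of it is PRINTED in this form ([I] p. 298; GAPS G-t4-U2-1∕-2) or asserted.  Row D4 class UNCHANGED (critical-path width 0; instance 0∕1; D4 DISCHARGE NO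
DATE).  NOT B12 Thm 2, NOT BetaPertH, NOT continuum YM, NOT Clay.

THE IDEA.  (E140a)'s link with the source comparison `E_{n+l} ≤ (1+τ)E_n + δ`: a negative dual step `−ν` now satisfies `ν ≤ θ(C + δ) − (1 − (1+τ)θ)E_n ≤ θ(C+δ)`, an
overshoot `≤ θC`; so a violation bound `C` improves to `θ(C + δ)`, whose iterates `θ^jC₀ + θδ(1 + θ + … ) ≤ θ^jC₀ + θδ∕(1−θ)` converge to the FIXED POINT `θδ∕(1−θ)`
instead of `0`: `X_n ≥ −θδ∕(1−θ)` at every depth.  The window-gap bookkeeping (E138a) `gap_le_sum_parts` (no signs) turns `j` such steps into the level deficit `j·θδ∕(1−θ)`.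

WHAT IS PROVED ([folklore]; 0 `def`, 0 sorry).  §1 (sequences) **`link_contract_osc`**, `violation_iterate_osc`, **`violation_le_osc`**.  §2 (flow) `flow_source_le_osc`,
**`dual_steps_osc`**.  §3 **`level_deficit_le`**.
-/

noncomputable section
open Finset Set

namespace Summit.QuantumFields.BalabanUV.Beta.EriceRemainderEnclosureHistoryAutonomyComparisonDefectOscillation

open Literature.MathematicalPhysics.QuantumFieldTheory.Balaban1983to89
open Literature.MathematicalPhysics.QuantumFieldTheory.Balaban1983to89.T4BetaStationary
open Literature.MathematicalPhysics.QuantumFieldTheory.Balaban1983to89.T4BetaFlowWellPosed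
open Summit.QuantumFields.BalabanUV.Beta.EriceRemainderEnclosureHistoryAutonomyOrder (strictAnti_of_memFlow)
open Summit.QuantumFields.BalabanUV.Beta.EriceRemainderEnclosureHistoryAutonomyComparisonDualContractionLinks (dual_step_eq_levels gap_le_sum_parts)
open Summit.QuantumFields.BalabanUV.Beta.EriceRemainderEnclosureHistoryAutonomyComparisonDualContraction
  (flow_link_lower flow_link_upper flow_violation_bound)

/-! ## §1 The contraction on sequences with a quasi-monotone source AND an oscillation: fixed point `θδ∕(1−θ)` -/

/-- **ONE LINK, SOURCE WITH DEFECT `τ` AND OSCILLATION `δ`.**  Sequences `X`, `E ≥ 0` with `E_{n+l+1} ≤ (1+τ)·E_n + δ` (`τ, δ ≥ 0`); profile `Λ ≥ 0` on `range K` with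
`θ = Σ_k k·Λ_k` and `(1+τ)θ ≤ 1`; the two link inequalities of (E138).  If the violations `X⁻_m`, `X_m − E_m` are `≤ C` everywhere, they are `≤ θ·(C + δ)` everywhere.
[folklore] -/
theorem link_contract_osc {X E Λ : ℕ → ℝ} {K : ℕ} {C τ δ : ℝ}
    (hΛ : ∀ k, 0 ≤ Λ k) (hτ : 0 ≤ τ) (hθτ : (1 + τ) * ∑ k ∈ range K, (k : ℝ) * Λ k ≤ 1) (hδ : 0 ≤ δ)
    (hE0 : ∀ n, 0 ≤ E n) (hEosc : ∀ n l, E (n + (l + 1)) ≤ (1 + τ) * E n + δ)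
    (hLm : ∀ n, E n - X n ≤ ∑ k ∈ range K, Λ k * ∑ l ∈ range (k + 1), max (X (n + l)) 0)
    (hLp : ∀ n, X n - E n ≤ ∑ k ∈ range K, Λ k * ∑ l ∈ range (k + 1), max (-X (n + l)) 0)
    (hC : ∀ m, max (-X m) 0 ≤ C ∧ X m - E m ≤ C) (n : ℕ) :
    max (-X n) 0 ≤ (∑ k ∈ range K, (k : ℝ) * Λ k) * (C + δ) ∧ X n - E n ≤ (∑ k ∈ range K, (k : ℝ) * Λ k) * (C + δ) := by
  set θ : ℝ := ∑ k ∈ range K, (k : ℝ) * Λ k with hθ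
  have hC0 : 0 ≤ C := (le_max_right _ _).trans (hC 0).1
  have hθ0 : 0 ≤ θ := sum_nonneg fun k _ => mul_nonneg (Nat.cast_nonneg k) (hΛ k)
  have hθC : 0 ≤ θ * (C + δ) := mul_nonneg hθ0 (by linarith)
  -- the later positive parts in a window: each at most (1+τ)·E n + δ + C
  have hpos : ∀ l, max (X (n + (l + 1))) 0 ≤ (1 + τ) * E n + δ + C := fun l =>
    max_le (by linarith [(hC (n + (l + 1))).2, hEosc n l]) (by nlinarith [hE0 n])
  have hneg : ∀ l, max (-X (n + (l + 1))) 0 ≤ C := fun l => (hC (n + (l + 1))).1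
  have hwinP : ∀ k ∈ range K, Λ k * ∑ l ∈ range (k + 1), max (X (n + l)) 0
      ≤ Λ k * max (X n) 0 + ((k : ℝ) * Λ k) * ((1 + τ) * E n + δ + C) := by
    intro k _
    rw [sum_range_succ', Nat.add_zero]
    have hs : ∑ l ∈ range k, max (X (n + (l + 1))) 0 ≤ ∑ l ∈ range k, ((1 + τ) * E n + δ + C) := sum_le_sum fun l _ => hpos l
    rw [sum_const, card_range, nsmul_eq_mul] at hs
    nlinarith [hΛ k, hs]
  have hwinN : ∀ k ∈ range K, Λ k * ∑ l ∈ range (k + 1), max (-X (n + l)) 0 ≤ Λ k * max (-X n) 0 + ((k : ℝ) * Λ k) * C := by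
    intro k _
    rw [sum_range_succ', Nat.add_zero]
    have hs : ∑ l ∈ range k, max (-X (n + (l + 1))) 0 ≤ ∑ l ∈ range k, C := sum_le_sum fun l _ => hneg l
    rw [sum_const, card_range, nsmul_eq_mul] at hs
    nlinarith [hΛ k, hs]
  have hLm' : E n - X n ≤ (∑ k ∈ range K, Λ k) * max (X n) 0 + θ * ((1 + τ) * E n + δ + C) := by
    refine (hLm n).trans ((sum_le_sum hwinP).trans_eq ?_)
    rw [sum_add_distrib, sum_mul, sum_mul]
  have hLp' : X n - E n ≤ (∑ k ∈ range K, Λ k) * max (-X n) 0 + θ * C := by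
    refine (hLp n).trans ((sum_le_sum hwinN).trans_eq ?_)
    rw [sum_add_distrib, sum_mul, sum_mul]
  have hsrc : (1 + τ) * θ * E n ≤ 1 * E n := mul_le_mul_of_nonneg_right hθτ (hE0 n)
  have hθδ : 0 ≤ θ * δ := mul_nonneg hθ0 hδ
  constructor
  · by_cases hX : 0 ≤ X n
    · rw [max_eq_right (by linarith)]; exact hθC
    · have hX' : X n < 0 := lt_of_not_ge hX
      rw [max_eq_left (by linarith)]
      rw [max_eq_right hX'.le, mul_zero, zero_add] at hLm'
      nlinarith [hE0 n, hsrc]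
  · by_cases hXE : X n ≤ E n
    · linarith
    · have hXE' : E n < X n := lt_of_not_ge hXE
      have hX0 : 0 ≤ X n := (hE0 n).trans hXE'.le
      rw [max_eq_right (by linarith), mul_zero, zero_add] at hLp'
      linarith

/-- THE ITERATES: with `θ < 1`, every violation is `≤ θ^j·C₀ + θδ∕(1−θ)` for every `j` (`θ(θ^jC₀ + θδ∕(1−θ) + δ) = θ^{j+1}C₀ + θδ∕(1−θ)`). [folklore] -/
theorem violation_iterate_osc {X E Λ : ℕ → ℝ} {K : ℕ} {C₀ τ δ : ℝ}
    (hΛ : ∀ k, 0 ≤ Λ k) (hθ : ∑ k ∈ range K, (k : ℝ) * Λ k < 1)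
    (hτ : 0 ≤ τ) (hθτ : (1 + τ) * ∑ k ∈ range K, (k : ℝ) * Λ k ≤ 1) (hδ : 0 ≤ δ)
    (hE0 : ∀ n, 0 ≤ E n) (hEosc : ∀ n l, E (n + (l + 1)) ≤ (1 + τ) * E n + δ)
    (hLm : ∀ n, E n - X n ≤ ∑ k ∈ range K, Λ k * ∑ l ∈ range (k + 1), max (X (n + l)) 0)
    (hLp : ∀ n, X n - E n ≤ ∑ k ∈ range K, Λ k * ∑ l ∈ range (k + 1), max (-X (n + l)) 0)
    (hC : ∀ m, max (-X m) 0 ≤ C₀ ∧ X m - E m ≤ C₀) (j : ℕ) :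
    ∀ m, max (-X m) 0 ≤ (∑ k ∈ range K, (k : ℝ) * Λ k) ^ j * C₀ + (∑ k ∈ range K, (k : ℝ) * Λ k) * δ / (1 - ∑ k ∈ range K, (k : ℝ) * Λ k)
      ∧ X m - E m ≤ (∑ k ∈ range K, (k : ℝ) * Λ k) ^ j * C₀ + (∑ k ∈ range K, (k : ℝ) * Λ k) * δ / (1 - ∑ k ∈ range K, (k : ℝ) * Λ k) := by
  set θ : ℝ := ∑ k ∈ range K, (k : ℝ) * Λ k with hθdef
  have hθ0 : 0 ≤ θ := sum_nonneg fun k _ => mul_nonneg (Nat.cast_nonneg k) (hΛ k)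
  have h1θ : 0 < 1 - θ := by linarith
  have hfix : 0 ≤ θ * δ / (1 - θ) := div_nonneg (mul_nonneg hθ0 hδ) h1θ.le
  induction j with
  | zero =>
    intro m
    rw [pow_zero, one_mul]
    exact ⟨(hC m).1.trans (by linarith), (hC m).2.trans (by linarith)⟩
  | succ j ih =>
    intro m
    have h := link_contract_osc hΛ hτ hθτ hδ hE0 hEosc hLm hLp ih m
    have e : θ * (θ ^ j * C₀ + θ * δ / (1 - θ) + δ) = θ ^ (j + 1) * C₀ + θ * δ / (1 - θ) := by
      rw [pow_succ]; field_simp; ring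
    rw [e] at h
    exact h

/-- **THE VIOLATIONS ARE AT MOST THE FIXED POINT `θδ∕(1−θ)`**: `−θδ∕(1−θ) ≤ X_n` and `X_n ≤ E_n + θδ∕(1−θ)` at every `n` (let `j → ∞` in `violation_iterate_osc`).
`δ = 0`: (E140a) `sandwich_of_links_defect`. [folklore] -/
theorem violation_le_osc {X E Λ : ℕ → ℝ} {K : ℕ} {C₀ τ δ : ℝ}
    (hΛ : ∀ k, 0 ≤ Λ k) (hθ : ∑ k ∈ range K, (k : ℝ) * Λ k < 1)
    (hτ : 0 ≤ τ) (hθτ : (1 + τ) * ∑ k ∈ range K, (k : ℝ) * Λ k ≤ 1) (hδ : 0 ≤ δ)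
    (hE0 : ∀ n, 0 ≤ E n) (hEosc : ∀ n l, E (n + (l + 1)) ≤ (1 + τ) * E n + δ)
    (hLm : ∀ n, E n - X n ≤ ∑ k ∈ range K, Λ k * ∑ l ∈ range (k + 1), max (X (n + l)) 0)
    (hLp : ∀ n, X n - E n ≤ ∑ k ∈ range K, Λ k * ∑ l ∈ range (k + 1), max (-X (n + l)) 0)
    (hC : ∀ m, max (-X m) 0 ≤ C₀ ∧ X m - E m ≤ C₀) (n : ℕ) :
    -((∑ k ∈ range K, (k : ℝ) * Λ k) * δ / (1 - ∑ k ∈ range K, (k : ℝ) * Λ k)) ≤ X n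
      ∧ X n - E n ≤ (∑ k ∈ range K, (k : ℝ) * Λ k) * δ / (1 - ∑ k ∈ range K, (k : ℝ) * Λ k) := by
  have iter := violation_iterate_osc hΛ hθ hτ hθτ hδ hE0 hEosc hLm hLp hC
  set θ : ℝ := ∑ k ∈ range K, (k : ℝ) * Λ k with hθdef
  set F : ℝ := θ * δ / (1 - θ) with hFdef
  have hC0 : 0 ≤ C₀ := (le_max_right _ _).trans (hC 0).1
  have hθ0 : 0 ≤ θ := sum_nonneg fun k _ => mul_nonneg (Nat.cast_nonneg k) (hΛ k)
  have hF0 : 0 ≤ F := div_nonneg (mul_nonneg hθ0 hδ) (by linarith)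
  have hsmall : ∀ ε : ℝ, 0 < ε → ∃ j : ℕ, θ ^ j * C₀ < ε := by
    intro ε hε
    obtain ⟨j, hj⟩ := exists_pow_lt_of_lt_one (div_pos hε (by linarith : (0 : ℝ) < C₀ + 1)) hθ
    refine ⟨j, ?_⟩
    have h1 : θ ^ j * C₀ ≤ θ ^ j * (C₀ + 1) := mul_le_mul_of_nonneg_left (by linarith) (pow_nonneg hθ0 j)
    have h2 : θ ^ j * (C₀ + 1) < ε := by
      have := (lt_div_iff₀ (by linarith : (0 : ℝ) < C₀ + 1)).mp hj
      linarith
    linarith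
  constructor
  · by_contra hX
    have hX' : X n < -F := lt_of_not_ge hX
    obtain ⟨j, hj⟩ := hsmall (-F - X n) (by linarith)
    have := (iter j n).1
    rw [max_eq_left (by linarith)] at this
    linarith
  · by_contra hX
    have hX' : F < X n - E n := lt_of_not_ge hX
    obtain ⟨j, hj⟩ := hsmall (X n - E n - F) (by linarith)
    linarith [(iter j n).2]

/-! ## §2 The flow: source with defect and oscillation, the dual steps are bounded below by `−θδ∕(1−θ)` -/

variable {B B' : (ℕ → ℝ) → ℝ} {M γ b : ℝ} {S : ℝ → ℕ → ℝ} {h h' : ℕ → ℝ}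

/-- THE SOURCE ALONG ONE ORBIT: `u ≤ v ⟹ (B′−B)u ≤ (1+τ)(B′−B)v + δ` on the box and `h′` a box solution of `B′` (`B′ ≥ b′ > 0`) give
`E_{n+l+1} ≤ (1+τ)E_n + δ`. [folklore] -/
theorem flow_source_le_osc {b' τ δ : ℝ} (hb' : 0 < b') (hlo' : ∀ u, SeqBox γ u → b' ≤ B' u)
    (hDosc : ∀ u v : ℕ → ℝ, SeqBox γ u → SeqBox γ v → (∀ i, u i ≤ v i) → B' u - B u ≤ (1 + τ) * (B' v - B v) + δ)
    (hh' : SeqBox γ h') {y : ℝ} (hf' : MemFlow B' y h') (n l : ℕ) :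
    B' (fun i => h' (n + (l + 1) + 1 + i)) - B (fun i => h' (n + (l + 1) + 1 + i))
      ≤ (1 + τ) * (B' (fun i => h' (n + 1 + i)) - B (fun i => h' (n + 1 + i))) + δ := by
  have hanti := (strictAnti_of_memFlow hb' hlo' hh' hf').antitone
  exact hDosc _ _ (fun i => hh' _) (fun i => hh' _) fun i => hanti (by omega)

/-- **THE DUAL STEPS ARE BOUNDED BELOW BY `−θδ∕(1−θ)`.**  Base `B`: isotone, floor `b > 0`, modulus `M`, unique box solutions `S q`, level-Lipschitz age profile `Λ ≥ 0` on the
graded box, `θ = Σ_{k<K} k·Λ_k < 1`; perturbed `B′`: `B ≤ B′ ≤ β̄`, excess with defect `τ ≥ 0` and oscillation `δ ≥ 0` (`u ≤ v ⟹ (B′−B)u ≤ (1+τ)(B′−B)v + δ`),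
`(1+τ)θ ≤ 1`; `h′` a box solution of `B′` from a pin in `]0,γ]`.  Then `−θδ∕(1−θ) ≤ X_n` and `X_n ≤ (B′−B)(tail_{n+1}h′) + θδ∕(1−θ)` for the dual steps
`X_n = 1∕h′_{n+1}² − 1∕(S h′_n)_1²`. [folklore] -/
theorem dual_steps_osc {Λ : ℕ → ℝ} {K : ℕ} {βb τ δ : ℝ} (hb : 0 < b)
    (hmono : ∀ u v : ℕ → ℝ, SeqBox γ u → SeqBox γ v → (∀ i, u i ≤ v i) → B u ≤ B v)
    (hB : ∀ u u' : ℕ → ℝ, SeqBox γ u → SeqBox γ u' → ∀ D : ℝ, (∀ j, |u j - u' j| ≤ D) → |B u - B u'| ≤ M * D) (hM : 0 ≤ M)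
    (hlo : ∀ u, SeqBox γ u → b ≤ B u)
    (hS : ∀ p, 0 < p → p ≤ γ → SeqBox γ (S p) ∧ MemFlow B p (S p))
    (huniq : ∀ p, 0 < p → p ≤ γ → ∀ u u' : ℕ → ℝ, SeqBox γ u → SeqBox γ u' → MemFlow B p u → MemFlow B p u' → u = u')
    (hΛ : ∀ k, 0 ≤ Λ k) (hθ : ∑ k ∈ range K, (k : ℝ) * Λ k < 1)
    (hτ : 0 ≤ τ) (hθτ : (1 + τ) * ∑ k ∈ range K, (k : ℝ) * Λ k ≤ 1) (hδ : 0 ≤ δ)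
    (hLip : ∀ u v : ℕ → ℝ, SeqBox γ u → SeqBox γ v → (∀ k : ℕ, 1 / γ ^ 2 + ((k : ℝ) + 1) * b ≤ 1 / u k ^ 2) →
      (∀ k : ℕ, 1 / γ ^ 2 + ((k : ℝ) + 1) * b ≤ 1 / v k ^ 2) → B u - B v ≤ ∑ k ∈ range K, Λ k * max (1 / v k ^ 2 - 1 / u k ^ 2) 0)
    (hexc : ∀ u, SeqBox γ u → B u ≤ B' u) (hbdd : ∀ u, SeqBox γ u → B' u ≤ βb)
    (hDosc : ∀ u v : ℕ → ℝ, SeqBox γ u → SeqBox γ v → (∀ i, u i ≤ v i) → B' u - B u ≤ (1 + τ) * (B' v - B v) + δ)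
    (hh' : SeqBox γ h') {y : ℝ} (hy : 0 < y) (hyγ : y ≤ γ) (hf' : MemFlow B' y h') (n : ℕ) :
    -((∑ k ∈ range K, (k : ℝ) * Λ k) * δ / (1 - ∑ k ∈ range K, (k : ℝ) * Λ k)) ≤ 1 / h' (n + 1) ^ 2 - 1 / S (h' n) 1 ^ 2
      ∧ (1 / h' (n + 1) ^ 2 - 1 / S (h' n) 1 ^ 2) - (B' (fun i => h' (n + 1 + i)) - B (fun i => h' (n + 1 + i)))
        ≤ (∑ k ∈ range K, (k : ℝ) * Λ k) * δ / (1 - ∑ k ∈ range K, (k : ℝ) * Λ k) := by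
  have hlo' : ∀ u, SeqBox γ u → b ≤ B' u := fun u hu => (hlo u hu).trans (hexc u hu)
  exact violation_le_osc (X := fun m => 1 / h' (m + 1) ^ 2 - 1 / S (h' m) 1 ^ 2)
    (E := fun m => B' (fun i => h' (m + 1 + i)) - B (fun i => h' (m + 1 + i))) hΛ hθ hτ hθτ hδ
    (fun m => sub_nonneg.mpr (hexc _ fun i => hh' (m + 1 + i)))
    (fun m l => flow_source_le_osc hb hlo' hDosc hh' hf' m l)
    (fun m => flow_link_lower hb hmono hB hM hlo hS huniq hΛ hLip hexc hh' hy hyγ hf' m)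
    (fun m => flow_link_upper hb hmono hB hM hlo hS huniq hΛ hLip hexc hh' hy hyγ hf' m)
    (fun m => flow_violation_bound hb hlo hS hexc hbdd hh' hf' m) n

/-! ## §3 The level deficit grows at most linearly in the depth -/

/-- **APPROXIMATE COMPARISON FOR SIGN-FREE EXCESSES WITH AN OSCILLATION.**  `B`: isotone on the box `]0,γ]^ℕ`, zeroth moment `M`, floor `b > 0`, LEVEL-LIPSCHITZ IN ITS
HISTORY with age profile `Λ ≥ 0` on the graded box (`B u − B v ≤ Σ_{k<K} Λ_k·(1∕v_k² − 1∕u_k²)⁺` when the age-`k` levels are `≥ 1∕γ² + (k+1)b`), `θ := Σ_{k<K} k·Λ_k < 1`.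
`B′`: ANY functional with `B ≤ B′ ≤ β̄` on the box whose excess `D = B′ − B` satisfies **`u ≤ v ⟹ D u ≤ (1+τ)·D v + δ`** (`τ, δ ≥ 0`; e.g. ANY bounded excess with
`τ = 0`, `δ = sup D − inf D`) and `(1+τ)θ ≤ 1`.  `h, h′`: ANY box solutions of `B, B′` from one pin `p`.  Then at every scale `j`
**`1∕h_j² − j·θδ∕(1−θ) ≤ 1∕h′_j²`**: the perturbed levels lag the base levels by at most `θδ∕(1−θ)` per scale (`δ = 0`: `h′ ≤ h`, (E140a)).  Proof: `dual_steps_osc` gives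
`X_n ≥ −θδ∕(1−θ)`; (E138a) `gap_le_sum_parts` (no signs) sums `j` of them from the pin. [folklore] -/
theorem level_deficit_le {Λ : ℕ → ℝ} {K : ℕ} {βb p τ δ : ℝ}
    (hmono : ∀ u v : ℕ → ℝ, SeqBox γ u → SeqBox γ v → (∀ i, u i ≤ v i) → B u ≤ B v)
    (hB : ∀ u u' : ℕ → ℝ, SeqBox γ u → SeqBox γ u' → ∀ D : ℝ, (∀ j, |u j - u' j| ≤ D) → |B u - B u'| ≤ M * D) (hM : 0 ≤ M)
    (hb : 0 < b) (hlo : ∀ u, SeqBox γ u → b ≤ B u)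
    (hΛ : ∀ k, 0 ≤ Λ k) (hθ : ∑ k ∈ range K, (k : ℝ) * Λ k < 1)
    (hτ : 0 ≤ τ) (hθτ : (1 + τ) * ∑ k ∈ range K, (k : ℝ) * Λ k ≤ 1) (hδ : 0 ≤ δ)
    (hLip : ∀ u v : ℕ → ℝ, SeqBox γ u → SeqBox γ v → (∀ k : ℕ, 1 / γ ^ 2 + ((k : ℝ) + 1) * b ≤ 1 / u k ^ 2) →
      (∀ k : ℕ, 1 / γ ^ 2 + ((k : ℝ) + 1) * b ≤ 1 / v k ^ 2) → B u - B v ≤ ∑ k ∈ range K, Λ k * max (1 / v k ^ 2 - 1 / u k ^ 2) 0)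
    (hexc : ∀ u, SeqBox γ u → B u ≤ B' u) (hbdd : ∀ u, SeqBox γ u → B' u ≤ βb)
    (hDosc : ∀ u v : ℕ → ℝ, SeqBox γ u → SeqBox γ v → (∀ i, u i ≤ v i) → B' u - B u ≤ (1 + τ) * (B' v - B v) + δ)
    (hp : 0 < p) (hpγ : p ≤ γ) (hh : SeqBox γ h) (hf : MemFlow B p h) (hh' : SeqBox γ h') (hf' : MemFlow B' p h') (j : ℕ) :
    1 / h j ^ 2 - (j : ℝ) * ((∑ k ∈ range K, (k : ℝ) * Λ k) * δ / (1 - ∑ k ∈ range K, (k : ℝ) * Λ k)) ≤ 1 / h' j ^ 2 := by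
  set F : ℝ := (∑ k ∈ range K, (k : ℝ) * Λ k) * δ / (1 - ∑ k ∈ range K, (k : ℝ) * Λ k) with hFdef
  -- the unique base family
  have hex : ∀ q : ℝ, 0 < q → q ≤ γ → ∃ k : ℕ → ℝ, SeqBox γ k ∧ MemFlow B q k :=
    fun q hq hqγ => Summit.QuantumFields.BalabanUV.Beta.EriceRemainderEnclosureHistoryAutonomyExistence.exists_memFlow_zm hB hM hq hqγ hb hlo
  choose! S hSb hSf using hex
  have hS : ∀ q, 0 < q → q ≤ γ → SeqBox γ (S q) ∧ MemFlow B q (S q) := fun q hq hqγ => ⟨hSb q hq hqγ, hSf q hq hqγ⟩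
  have huniq : ∀ q, 0 < q → q ≤ γ → ∀ u u' : ℕ → ℝ, SeqBox γ u → SeqBox γ u' → MemFlow B q u → MemFlow B q u' → u = u' :=
    fun q hq _ u u' hu hu' hfu hfu' =>
      Summit.QuantumFields.BalabanUV.Beta.EriceRemainderEnclosureHistoryAutonomyMonotoneGeneral.memFlow_unique_of_monotone_zm
        hmono hB hM hq hb hlo hu hu' hfu hfu'
  have e : h = S p := huniq p hp hpγ _ _ hh (hS p hp hpγ).1 hf (hS p hp hpγ).2
  rcases Nat.eq_zero_or_pos j with hj0 | hjpos
  · -- scale 0 is the common pin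
    subst hj0
    rw [hf.1, hf'.1]
    simp
  · obtain ⟨k, rfl⟩ : ∃ k, j = k + 1 := ⟨j - 1, by omega⟩
    -- window gap from the pin (no signs) and the dual-step lower bound
    have hgap := (gap_le_sum_parts hb hmono hB hM hlo hS huniq hh' k 0).2
    have hX : ∀ l, max (-(1 / h' (0 + l + 1) ^ 2 - 1 / S (h' (0 + l)) 1 ^ 2)) 0 ≤ F := fun l =>
      max_le (by linarith [(dual_steps_osc hb hmono hB hM hlo hS huniq hΛ hθ hτ hθτ hδ hLip hexc hbdd hDosc hh' hp hpγ hf' (0 + l)).1])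
        (by
          have hθ0 : 0 ≤ ∑ k ∈ range K, (k : ℝ) * Λ k := sum_nonneg fun k _ => mul_nonneg (Nat.cast_nonneg k) (hΛ k)
          exact div_nonneg (mul_nonneg hθ0 hδ) (by linarith))
    have hsum : ∑ l ∈ range (k + 1), max (-(1 / h' (0 + l + 1) ^ 2 - 1 / S (h' (0 + l)) 1 ^ 2)) 0 ≤ ((k : ℝ) + 1) * F := by
      have hs := sum_le_sum fun l (_ : l ∈ range (k + 1)) => hX l
      rw [sum_const, card_range, nsmul_eq_mul] at hs
      push_cast at hs
      linarith
    have hgap0 := hgap.trans hsum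
    have hidx1 : h' (0 + 1 + k) = h' (k + 1) := congrArg h' (by omega)
    have hidx2 : S (h' 0) (1 + k) = h (k + 1) := by rw [hf'.1, ← e, Nat.add_comm]
    rw [hidx1] at hgap0
    rw [hidx2] at hgap0
    push_cast
    linarith

end Summit.QuantumFields.BalabanUV.Beta.EriceRemainderEnclosureHistoryAutonomyComparisonDefectOscillation

end
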